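import Summits.KontsevichZagierPeriods.KontsevichZagierPeriods.Theorems.ReductionTwoSix.Negative.Relative
import Summits.KontsevichZagierPeriods.KontsevichZagierPeriods.Theorems.HurwitzMicroSectorsDilationMove
import Literature.NumberTheory.Transcendental.BoxIntegralHurwitz

/-!
# `HurwitzSectorComplement` (stmt-KontsevichZagierPeriods-14341), line `galois-parity-half`,
# stub S1 `stub_symReduction` — part 1/4: the level-`L` sector kit in weight `w`

The weight-`w`, level-`L` box sector consists of the representations `[(0,1)^w, P(t)/(1 − t^L)]`,
`t = x₀⋯x_{w−1}`, `P ∈ ℚ[t]`. This file provides, def-free (everything is packaged as `∃`):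

* `exists_sectorFamily` — a canonical family `σ : ℚ[t] → KZ.IntegralRep w` of sector members
  (`KZ.IntegralRep.ofRational`; integrability from `BoxIntegral.integrableOn_box_prod_pow_div_one_sub_prod_pow`);
* for ANY such family (section `Family`): integrand additivity `cls_sigma_add`, congruence
  `cls_eq_sigma`, ONE dilation move `cls_dil` (the proved crux `DilationMove_of`, dimension `w`),
  the DISTRIBUTION RELATIONS `cls_dilation`
  (`[q g^w t^{g(β+1)−1}/(1−t^L)] = [q t^β (1 + t^M + ⋯ + t^{(g−1)M})/(1−t^L)]`, `gM = L`) and the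
  JACOBIAN MONOMIALS `cls_monomial` (`[q (k+1)^w t^k] = [q]`), each for every rational scalar `q`;
* `exists_kernel` — consequently the polynomials `P` all of whose rational multiples have class
  `0` form a `ℚ`-SUBMODULE `K ⊆ ℚ[t]` containing the relation polynomials
  `X^β Σ_{j<g} X^{jM} − g^w X^{g(β+1)−1}` and `((k+1)^w X^k − 1)(1 − X^L)`, and `P − P' ∈ K` forces
  `cls (σ P) = cls (σ P')`. Rational rescaling thus lives inside the integrands: no division move.

References: M. Kontsevich, D. Zagier, *Periods* (2001), §1.2 rules (1b), (2); J. Milnor,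
*On polylogarithms, Hurwitz zeta functions, and the Kubert identities*, Enseign. Math. 29 (1983), §1.
-/

noncomputable section

open Set MeasureTheory Polynomial
open scoped BigOperators
open Literature.NumberTheory.Transcendental
open Literature.ModelTheory.ExponentialFields (IsSemialgebraic)
open Summit.KontsevichZagierPeriods.HurwitzMicroSectors.ReductionTwoSixNegative

namespace Summit.KontsevichZagierPeriods.Theorems.HurwitzMicroSectorsHurwitzSectorComplement.SymReduction

variable {w : ℕ}

/-! ## The open box `(0,1)^w` and the sector integrands -/

/-- On `(0,1)`, `1 − t^m ≠ 0` for `m ≠ 0`. [folklore] -/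
theorem one_sub_pow_ne_zero {t : ℝ} (ht : t ∈ Ioo (0 : ℝ) 1) {m : ℕ} (hm : m ≠ 0) :
    1 - t ^ m ≠ 0 :=
  (sub_pos.mpr (pow_lt_one₀ ht.1.le ht.2 hm)).ne'

/-- The open unit box `(0,1)^w` is `ℚ`-semialgebraic (`2w` strict polynomial inequalities).
[folklore] -/
theorem isSemialgebraic_unitBox (w : ℕ) :
    IsSemialgebraic ℚ {x : Fin w → ℝ | ∀ i, x i ∈ Set.Ioo (0 : ℝ) 1} := by
  have h : {x : Fin w → ℝ | ∀ i, x i ∈ Set.Ioo (0 : ℝ) 1} =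
      ⋂ j ∈ (Finset.univ : Finset (Fin w)),
        ({x | 0 < MvPolynomial.aeval x (MvPolynomial.X j : MvPolynomial (Fin w) ℚ)} ∩
          {x | 0 < MvPolynomial.aeval x (1 - MvPolynomial.X j : MvPolynomial (Fin w) ℚ)}) := by
    ext x
    simp [sub_pos]
  rw [h]
  exact Literature.ModelTheory.ExponentialFields.IsSemialgebraic.biInter _ _ fun j _ =>
    (Literature.ModelTheory.ExponentialFields.isSemialgebraic_setOf_eval_pos _).inter
      (Literature.ModelTheory.ExponentialFields.isSemialgebraic_setOf_eval_pos _)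

/-- Evaluation of the `w`-variable numerator: `P(X₀⋯X_{w−1})(x) = P(x₀⋯x_{w−1})`. [folklore] -/
theorem aeval_num (P : ℚ[X]) (x : Fin w → ℝ) :
    MvPolynomial.aeval x
        (Polynomial.aeval (∏ i, MvPolynomial.X i : MvPolynomial (Fin w) ℚ) P) =
      Polynomial.aeval (∏ i, x i) P := by
  rw [← Polynomial.aeval_algHom_apply, map_prod]
  simp

/-- Every level-`L` sector integrand `P(t)/(1 − t^L)` (`t = x₀⋯x_{w−1}`, `w ≥ 2`, `L ≥ 1`) is
integrable on the open box: a finite `ℚ`-combination of the Hurwitz kernels `t^i/(1 − t^L)`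
(`BoxIntegral.integrableOn_box_prod_pow_div_one_sub_prod_pow`). [folklore] -/
theorem integrableOn_sector (hw : 2 ≤ w) {L : ℕ} (hL : 1 ≤ L) (P : ℚ[X]) :
    IntegrableOn (fun x : Fin w → ℝ => Polynomial.aeval (∏ i, x i) P / (1 - (∏ i, x i) ^ L))
      {x | ∀ i, x i ∈ Set.Ioo (0 : ℝ) 1} := by
  have hsum : IntegrableOn (fun x : Fin w → ℝ => ∑ i ∈ Finset.range (P.natDegree + 1),
      (P.coeff i : ℝ) * ((∏ j, x j) ^ i / (1 - (∏ j, x j) ^ L)))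
      {x | ∀ i, x i ∈ Set.Ioo (0 : ℝ) 1} volume :=
    integrable_finsetSum _ fun i _ =>
      (BoxIntegral.integrableOn_box_prod_pow_div_one_sub_prod_pow hw hL i).const_mul _
  refine hsum.congr_fun (fun x _ => ?_) (Beukers.measurableSet_cube w)
  rw [Polynomial.aeval_eq_sum_range, Finset.sum_div]
  refine Finset.sum_congr rfl fun i _ => ?_
  rw [Algebra.smul_def, eq_ratCast, mul_div_assoc]

/-- **A canonical level-`L` sector family exists** (`w ≥ 2`, `L ≥ 1`): `σ : ℚ[t] → KZ.IntegralRep w`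
with `(σ P).domain = (0,1)^w` and `(σ P).integrand x = P(t)/(1 − t^L)`, `t = ∏ xᵢ`, namely
`KZ.IntegralRep.ofRational` on the numerator `P(∏ Xᵢ)` and the denominator `1 − (∏ Xᵢ)^L`.
[cite: KontsevichZagier2001, §1.1] -/
theorem exists_sectorFamily (hw : 2 ≤ w) {L : ℕ} (hL : 1 ≤ L) :
    ∃ σ : ℚ[X] → KZ.IntegralRep w, (∀ P, (σ P).domain = {x | ∀ i, x i ∈ Set.Ioo (0 : ℝ) 1}) ∧
      ∀ (P : ℚ[X]) (x : Fin w → ℝ),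
        (σ P).integrand x = Polynomial.aeval (∏ i, x i) P / (1 - (∏ i, x i) ^ L) := by
  have hden : ∀ x : Fin w → ℝ, MvPolynomial.aeval x
      (1 - (∏ i, MvPolynomial.X i : MvPolynomial (Fin w) ℚ) ^ L) = 1 - (∏ i, x i) ^ L :=
    fun x => by simp [map_prod]
  have hq : ∀ x ∈ {x : Fin w → ℝ | ∀ i, x i ∈ Set.Ioo (0 : ℝ) 1}, MvPolynomial.aeval x
      (1 - (∏ i, MvPolynomial.X i : MvPolynomial (Fin w) ℚ) ^ L) ≠ 0 := fun x hx => by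
    rw [hden]
    exact one_sub_pow_ne_zero (BoxIntegral.prod_mem_Ioo (by omega) hx) (by omega)
  refine ⟨fun P => KZ.IntegralRep.ofRational {x | ∀ i, x i ∈ Set.Ioo (0 : ℝ) 1}
      (Polynomial.aeval (∏ i, MvPolynomial.X i : MvPolynomial (Fin w) ℚ) P)
      (1 - (∏ i, MvPolynomial.X i : MvPolynomial (Fin w) ℚ) ^ L)
      (isSemialgebraic_unitBox w) hq
      ((integrableOn_sector hw hL P).congr_fun (fun x _ => by rw [aeval_num, hden])
        (Beukers.measurableSet_cube w)),
    fun P => rfl, fun P x => ?_⟩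
  rw [KZ.IntegralRep.integrand_ofRational]
  exact congrArg₂ (· / ·) (aeval_num P x) (hden x)

/-! ## The calculus of an arbitrary level-`L` sector family `σ` -/

section Family

variable {L : ℕ} {σ : ℚ[X] → KZ.IntegralRep w}

/-- Equal numerators give equal classes. [folklore] -/
theorem cls_sigma_congr {P P' : ℚ[X]} (h : P = P') : cls (σ P) = cls (σ P') := by rw [h]

variable (H : (∀ P, (σ P).domain = {x | ∀ i, x i ∈ Set.Ioo (0 : ℝ) 1}) ∧
  ∀ (P : ℚ[X]) (x : Fin w → ℝ),
    (σ P).integrand x = Polynomial.aeval (∏ i, x i) P / (1 - (∏ i, x i) ^ L))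
include H

/-- Integrand additivity (rule 1b) in the quotient by the moves:
`cls [P₁ + P₂] = cls [P₁] + cls [P₂]`. [cite: KontsevichZagier2001, §1.2 rule (1)] -/
theorem cls_sigma_add (P₁ P₂ : ℚ[X]) : cls (σ (P₁ + P₂)) = cls (σ P₁) + cls (σ P₂) :=
  cls_add _ _ _ ((H.1 P₁).trans (H.1 _).symm) ((H.1 P₂).trans (H.1 _).symm) fun x _ => by
    rw [Pi.add_apply, H.2, H.2, H.2, map_add, add_div]

/-- The sector map `P ↦ cls [(0,1)^w, P(t)/(1−t^L)]` is an additive homomorphism `ℚ[X] →+ Q`.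
[cite: KontsevichZagier2001, §1.2 rule (1)] -/
theorem exists_addHom : ∃ S : ℚ[X] →+ Q, ∀ P, S P = cls (σ P) :=
  ⟨AddMonoidHom.mk' (fun P => cls (σ P)) (cls_sigma_add H), fun _ => rfl⟩

/-- Every member of the sector (domain the open box, integrand `= P(t)/(1−t^L)` on it) has the class
of the canonical member `σ P`. [cite: KontsevichZagier2001, §1.2 rule (1)] -/
theorem cls_eq_sigma (r : KZ.IntegralRep w) (P : ℚ[X])
    (hdom : r.domain = {x | ∀ i, x i ∈ Set.Ioo (0 : ℝ) 1})
    (hint : EqOn r.integrand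
      (fun x => Polynomial.aeval (∏ i, x i) P / (1 - (∏ i, x i) ^ L)) r.domain) :
    cls r = cls (σ P) :=
  cls_congr r _ (by rw [H.1, hdom]) fun x hx => by rw [hint hx, H.2]

/-- ONE dilation move between two sector members (the dimension-`w` slice of the proved crux
`DilationMove_of`): if `(σ P).integrand x = (σ P').integrand (xᵢᵐ)ᵢ · m^w ∏ xᵢ^(m−1)` on the box
(`m ≥ 1`) then `cls (σ P) = cls (σ P')`. [cite: KontsevichZagier2001, §1.2 rule (2)] -/
theorem cls_dil (m : ℕ) (hm : 1 ≤ m) (P P' : ℚ[X])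
    (h : ∀ x ∈ {x : Fin w → ℝ | ∀ i, x i ∈ Set.Ioo (0 : ℝ) 1}, (σ P).integrand x =
      (σ P').integrand (fun i => x i ^ m) * ((m : ℝ) ^ w * ∏ i, x i ^ (m - 1))) :
    cls (σ P) = cls (σ P') := by
  have hD : DilationMoveDim w := dilationMove_iff_forall_dim.mp
    Summit.KontsevichZagierPeriods.HurwitzMicroSectors.DilationMove.DilationMove_of w
  have hmem := KZ.changeOfVariablesRel_subset_relations
    (hD m hm (σ P) (σ P') (H.1 P) (H.1 P') fun x hx => h x (by rwa [H.1] at hx))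
  rw [cls, cls, ← sub_eq_zero, ← QuotientAddGroup.mk_sub]
  exact (QuotientAddGroup.eq_zero_iff _).mpr hmem

/-- **The distribution relations as single moves.** For `g ≥ 1`, `gM = L` and every `β`, `q`:
`[q g^w t^{g(β+1)−1}/(1−t^L)] = [q t^β (Σ_{j<g} t^{jM})/(1−t^L)]` — ONE dilation `xᵢ ↦ xᵢ^g`
(`Σ_{j<g} t^{gjM} = (1 − t^{gL})/(1 − t^L)`); in Hurwitz terms `g^w ζ(w, x) = Σ_{gy = x} ζ(w, y)`.
[cite: Milnor1983, §1] -/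
theorem cls_dilation (hw0 : w ≠ 0) (hL : L ≠ 0) (g M β : ℕ) (hg : 1 ≤ g) (hgM : g * M = L)
    (q : ℚ) :
    cls (σ (C (q * (g : ℚ) ^ w) * X ^ (g * (β + 1) - 1))) =
      cls (σ (C q * X ^ β * ∑ j ∈ Finset.range g, X ^ (j * M))) := by
  refine cls_dil H g hg _ _ fun x hx => ?_
  have ht := BoxIntegral.prod_mem_Ioo hw0 hx
  rw [H.2, H.2]
  simp only [map_mul, map_pow, map_sum, Polynomial.aeval_C, Polynomial.aeval_X, eq_ratCast,
    Finset.prod_pow]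
  generalize ∏ i, x i = t at ht ⊢
  have hD1 : (1 : ℝ) - t ^ L ≠ 0 := one_sub_pow_ne_zero ht hL
  have hsum : ∑ j ∈ Finset.range g, (t ^ g) ^ (j * M) = ∑ j ∈ Finset.range g, (t ^ L) ^ j :=
    Finset.sum_congr rfl fun j _ => by
      rw [← pow_mul, ← pow_mul, ← hgM]
      congr 1
      ring
  have hG : (1 : ℝ) - (t ^ g) ^ L = (∑ j ∈ Finset.range g, (t ^ L) ^ j) * (1 - t ^ L) := by
    rw [geom_sum_mul_neg, ← pow_mul, ← pow_mul, mul_comm]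
  have hGne : ∑ j ∈ Finset.range g, (t ^ L) ^ j ≠ 0 :=
    (Finset.sum_pos (fun j _ => pow_pos (pow_pos ht.1 L) j)
      (Finset.nonempty_range_iff.mpr (by omega))).ne'
  have hE : t ^ (g * (β + 1) - 1) = (t ^ g) ^ β * t ^ (g - 1) := by
    rw [← pow_mul, ← pow_add]
    congr 1
    rw [mul_add_one]
    omega
  rw [hsum, hG, hE]
  push_cast
  field_simp

/-- **Jacobian monomials.** `[q (k+1)^w t^k] = [q]` on the box — ONE dilation `xᵢ ↦ xᵢ^{k+1}`
applied to the constant `q` (numerators `q(k+1)^w X^k (1 − X^L)` and `q (1 − X^L)`): the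
polynomial part needs no Newton–Leibniz move. [cite: KontsevichZagier2001, §1.2 rule (2)] -/
theorem cls_monomial (hw0 : w ≠ 0) (hL : L ≠ 0) (q : ℚ) (k : ℕ) :
    cls (σ (C (q * ((k : ℚ) + 1) ^ w) * X ^ k * (1 - X ^ L))) = cls (σ (C q * (1 - X ^ L))) := by
  refine cls_dil H (k + 1) (Nat.succ_le_succ (Nat.zero_le k)) _ _ fun x hx => ?_
  have ht := BoxIntegral.prod_mem_Ioo hw0 hx
  rw [H.2, H.2]
  simp only [map_mul, map_pow, map_sub, map_one, Polynomial.aeval_C, Polynomial.aeval_X,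
    eq_ratCast, Finset.prod_pow, Nat.add_sub_cancel]
  generalize ∏ i, x i = t at ht ⊢
  have h1 : (1 : ℝ) - t ^ L ≠ 0 := one_sub_pow_ne_zero ht hL
  have h2 : (1 : ℝ) - (t ^ (k + 1)) ^ L ≠ 0 := by
    rw [← pow_mul]
    exact one_sub_pow_ne_zero ht (Nat.mul_ne_zero (Nat.succ_ne_zero k) hL)
  push_cast
  field_simp

/-- **The kernel is a `ℚ`-submodule containing the relation polynomials.** For any sector family
there is a `ℚ`-submodule `K ⊆ ℚ[t]` (the numerators all of whose rational multiples have class `0`)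
such that `P − P' ∈ K ⇒ cls (σ P) = cls (σ P')`, containing the distribution polynomials
`X^β Σ_{j<g} X^{jM} − g^w X^{g(β+1)−1}` (`g ≥ 1`, `gM = L`) and the Jacobian polynomials
`((k+1)^w X^k − 1)(1 − X^L)`. Rational rescaling happens inside the integrands (`cls_dilation`,
`cls_monomial` hold for every scalar `q`), so no division move is used. [cite: Milnor1983, §1] -/
theorem exists_kernel (hw0 : w ≠ 0) (hL : L ≠ 0) : ∃ K : Submodule ℚ ℚ[X],
    (∀ P P' : ℚ[X], P - P' ∈ K → cls (σ P) = cls (σ P')) ∧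
    (∀ g M β : ℕ, 1 ≤ g → g * M = L →
      X ^ β * (∑ j ∈ Finset.range g, X ^ (j * M)) - C ((g : ℚ) ^ w) * X ^ (g * (β + 1) - 1) ∈ K) ∧
    (∀ k : ℕ, (C (((k : ℚ) + 1) ^ w) * X ^ k - 1) * (1 - X ^ L) ∈ K) := by
  obtain ⟨S, hS⟩ := exists_addHom H
  let K : Submodule ℚ ℚ[X] :=
    { carrier := {P | ∀ q : ℚ, S (C q * P) = 0}
      add_mem' := fun {P P'} hP hP' q => by
        show S (C q * (P + P')) = 0
        rw [mul_add, map_add, hP q, hP' q, add_zero]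
      zero_mem' := fun q => by
        show S (C q * 0) = 0
        rw [mul_zero, map_zero]
      smul_mem' := fun c P hP q => by
        show S (C q * (c • P)) = 0
        rw [smul_eq_C_mul, ← mul_assoc, ← C_mul]
        exact hP _ }
  have hK : ∀ P, P ∈ K ↔ ∀ q : ℚ, S (C q * P) = 0 := fun P => Iff.rfl
  refine ⟨K, fun P P' h => ?_, fun g M β hg hgM => ?_, fun k => ?_⟩
  · have h1 := (hK _).mp h 1
    rwa [C_1, one_mul, map_sub, sub_eq_zero, hS, hS] at h1
  · refine (hK _).mpr fun q => ?_
    rw [mul_sub, map_sub, sub_eq_zero, hS, hS, ← mul_assoc, ← mul_assoc, ← C_mul]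
    exact (cls_dilation H hw0 hL g M β hg hgM q).symm
  · refine (hK _).mpr fun q => ?_
    have e : C q * ((C (((k : ℚ) + 1) ^ w) * X ^ k - 1) * (1 - X ^ L)) =
        C (q * ((k : ℚ) + 1) ^ w) * X ^ k * (1 - X ^ L) - C q * (1 - X ^ L) := by
      simp only [C_mul]
      ring
    rw [e, map_sub, hS, hS, cls_monomial H hw0 hL q k, sub_self]

end Family

/-! ## The kit, packaged (registered sub-goal `symReduction_kit`) -/

/-- **The level-`L` sector kit in weight `w`** (`w ≥ 2`, `L ≥ 1`), packaged for the stub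
`stub_symReduction`: a canonical family `σ` of sector members `[(0,1)^w, P(t)/(1 − t^L)]` and a
`ℚ`-submodule `K ⊆ ℚ[t]` of numerators such that (i) every sector member with numerator `P` is
KZ-equivalent to `σ P`; (ii) `P − P' ∈ K ⇒ σ P ∼ σ P'`; (iii) `K` contains the distribution
polynomials `X^β Σ_{j<g} X^{jM} − g^w X^{g(β+1)−1}` (`g ≥ 1`, `gM = L`: ONE dilation `xᵢ ↦ xᵢ^g` each)
and the Jacobian polynomials `((k+1)^w X^k − 1)(1 − X^L)` (ONE dilation `xᵢ ↦ xᵢ^{k+1}` each).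
[cite: Milnor1983, §1] -/
theorem symReduction_kit : ∀ (w L : ℕ), 2 ≤ w → 1 ≤ L → ∃ (σ : Polynomial ℚ → KZ.IntegralRep w) (K : Submodule ℚ (Polynomial ℚ)), (∀ P : Polynomial ℚ, (σ P).domain = {x | ∀ i, x i ∈ Set.Ioo (0:ℝ) 1}) ∧ (∀ (P : Polynomial ℚ) (x : Fin w → ℝ), (σ P).integrand x = Polynomial.aeval (∏ i, x i) P / (1 - (∏ i, x i) ^ L)) ∧ (∀ (r : KZ.IntegralRep w) (P : Polynomial ℚ), r.domain = {x | ∀ i, x i ∈ Set.Ioo (0:ℝ) 1} → Set.EqOn r.integrand (fun x => Polynomial.aeval (∏ i, x i) P / (1 - (∏ i, x i) ^ L)) r.domain → KZ.Equivalent r (σ P)) ∧ (∀ P P' : Polynomial ℚ, P - P' ∈ K → KZ.Equivalent (σ P) (σ P')) ∧ (∀ g M β : ℕ, 1 ≤ g → g * M = L → Polynomial.X ^ β * (∑ j ∈ Finset.range g, Polynomial.X ^ (j * M)) - Polynomial.C ((g : ℚ) ^ w) * Polynomial.X ^ (g * (β + 1) - 1) ∈ K) ∧ (∀ k : ℕ,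 (Polynomial.C (((k : ℚ) + 1) ^ w) * Polynomial.X ^ k - 1) * (1 - Polynomial.X ^ L) ∈ K) := by
  intro w L hw hL
  obtain ⟨σ, H⟩ := exists_sectorFamily (w := w) hw hL
  obtain ⟨K, hK, hD, hE⟩ := exists_kernel H (by omega) (by omega)
  exact ⟨σ, K, H.1, H.2, fun r P hdom hint => cls_eq_iff.mp (cls_eq_sigma H r P hdom hint),
    fun P P' h => cls_eq_iff.mp (hK P P' h), hD, hE⟩

end Summit.KontsevichZagierPeriods.Theorems.HurwitzMicroSectorsHurwitzSectorComplement.SymReduction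

end
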